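import Literature.MathematicalPhysics.QuantumFieldTheory.Balaban1983to89.B1TorusCubeDeriv
import Literature.MathematicalPhysics.QuantumFieldTheory.Balaban1983to89.B4Eq221HjRegion

/-!
# `Balaban1983to89.B1TorusRegionHSizes` — [Balaban1983RegularityDecay] §2 p. 575–577 ON THE (Higgs)₂,₃ TORUS `T_ε` OF
# [Balaban1982Higgs1]: the three printed sizes of the partition bumps «|∂^ηh_j| ≤ O(M⁻¹), |Δ^ηh_j| ≤ O(M⁻²)» and the block
# oscillation of `h_j`, the BIG-BLOCK REGIONS («thus Ω is a sum of the corresponding large blocks», p. 575) and the FLAT NORMAL of `h_j`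
# across their faces — «we have
# used the fact that the normal derivative of h_j to the boundary of □_j is equal to 0» (p. 576) — whence the Neumann Laplacian of
# `h_j` on a boundary piece `Ω ∩ □_j` IS its full lattice Laplacian: the geometric inputs of Lemma 2.1's `L²` letter at boundary cubes

statement-level skeleton of published theorems with citation tags; proofs where landed; nothing here is a claim about the Yang–Mills mass gap

PDF held: `paper:balaban1983-cmp89-regularity-decay` pp. 575–577 [PDF 5–7] (text layer re-read by this seat);
`paper:balaban1982-cmp85-higgs23-i` p. 610 [PDF 8].

CITATION HEADER (lean-in-tree rule).  T. Bałaban, *Regularity and decay of lattice Green's functions*, Commun. Math. Phys. **89**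
(1983) 571–597 [Balaban1983RegularityDecay] (§2 pp. 575–577) and T. Bałaban, *(Higgs)₂,₃ quantum fields in a finite volume. I*,
Commun. Math. Phys. **85** (1982) 603–626 [Balaban1982Higgs1] (Prop. 2.1 p. 610: «Let a set Ω satisfies Ω = B^k(Ω^{(k)}) and let
Ω^{(k)} ⊂ T₁^{(k)} be a sum of big blocks»).  Cell `lit-balaban` (HOME `run/shared/lean/pub/lit-balaban/`), Phase-2 proof seat **p35**
gen 12 (unit `lit-balaban-p35`); SKELETON rows **B4.Def§2** (the partition `h_j` and its sizes, torus model instance), **B4.Eq2.7**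
(«normal derivative of h_j … equal to 0», for big-block regions of `T_ε`), feeding **B4.Lem2.1** / **B1.Prop2.1** for regions on the
carrier.  USED BY NAME, never restated: this seat's gen-8 `B1TorusCubeCover` (`hTor`, `Near`, `cube`, `half`), gen-8
`B1TorusCubeChart` (`fromT`, `toT`, the box `Box`), gen-8 `B1TorusCubeBoxOp.hTor_toT` (the bump along the chart is the lineage's `hBox`),
gen-9 `B1TorusCubeDeriv.abs_hTor_shift_sub_le` (the first size), r01's `B4Eq220PartitionSizes.hsize_hBox` (the three sizes of `hBox` on
a box: `grad_le`, `lap_le`, `osc_le`), p35 g5's `B4Eq221HjRegion.hZ_add_e1_eq_of_dvd` (flatness of the lineage's `hZ` across the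
`nK`-grid), p23's `B2Ineq329ZeroAveraging.val_blockIter`.

WHAT IS PRINTED.  p. 572: *«We consider also a second division of ηZ^d into cubes of size M called big blocks. … We consider
subsets Ω which are unions of big blocks.»*  p. 575: *«h_j(x) = Π_μ h_{j_μ}(x_μ), … h_j(x) = h(x/M − j), h ∈ C₀^∞(]−⅔, ⅔[), h(x) = 1 for
x ∈ [−⅓, ⅓], and it is chosen in such a way that Σ_j h_j² = 1»* (locator docfix S-B1-g44-2 of ref-4 gen 44 = ref-1 gen 60 F1, filed gen 13;
no declaration changed).
p. 576: *«(2.7) where we have used the fact that the normal derivative of h_j to the boundary of □_j is equal to 0.»*  p. 577: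
*«R is a small operator in reasonable norms because |∂^ηh_j| ≤ O(M⁻¹), |Δ^ηh_j| ≤ O(M⁻²)».*

WHAT THIS FILE PROVES (kernel-checked, zero `sorry`; one definition with body + theorems; no `def … : Prop` fact).
* §1 `IsBigBlockUnion K K₀ Ω` — «Ω is a sum of the corresponding large blocks of the size M» on `T_ε`: membership depends only on the
  big-block index `⌊x_μ/M⌋`
  (`M = half = L^K·K₀` fine sites); `blockSat_of_isBigBlockUnion` (⇒ a union of `K`-blocks, the hypothesis of r14's (1.8) for regions);
  `univ`/`∅` are big-block unions; `dvd_of_crossing` — a lattice bond with exactly one end in `Ω` crosses a face `{x_μ ≡ −1 mod M}`.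
* §2 THE THREE SIZES OF `h_j` ON `T_ε` (chart transfer of `hsize_hBox`; `K₀ ≥ 8`, `K ≤ K_P`, `K₀ ∣ M_P`, `3M ≤ |T_ε|_μ`):
  `abs_lapH_hTor_le` (`|Σ_μ(h_j(x+εe_μ) − 2h_j(x) + h_j(x−εe_μ))| ≤ d(D₁+D₂)/(K₀²L^{2K})`, the printed `|Δ^ηh_j| ≤ O(M⁻²)` in lattice
  units) and `abs_hTor_sub_le_of_blockIter_eq` (`|h_j(x) − h_j(x′)| ≤ d(D₁+D₂)/K₀` inside one `K`-block — the size behind `R_k(A, ∂^ηh)`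
  of (2.8)); the first size is gen 9's `abs_hTor_shift_sub_le`.
* §3 **THE FLAT NORMAL**: `hTor_shift_eq_of_dvd` (`M ∣ x_μ + 1 ⇒ h_j(x + εe_μ) = h_j(x)`) and `hTor_shift_eq_of_crossing` — across a
  boundary bond of a big-block union every `h_j` takes equal values at the two ends («the normal derivative of h_j to the boundary … is
  equal to 0»); `hTor_eq_zero_of_shift_not_mem_cube` (bonds leaving the window carry `h_j = 0` at both ends).
* §4 `nlapH`, `flapH` (the Neumann Laplacian of a scalar on a piece `Π` and the full lattice Laplacian, lattice units) and
  **`nlapH_piece_eq_flapH`**: on `Π = Ω ∩ □_j`, `Ω` a big-block union, `(Δ^{N}_Π h_j)(x) = (Δh_j)(x)` at every `x ∈ Π`; with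
  `abs_flapH_hTor_le`, the printed `|Δ^ηh_j| ≤ O(M⁻²)` holds for the NEUMANN Laplacian of the boundary pieces.
HONEST SCOPE.  Geometry of the bumps only; sizes in lattice units of `T_ε` (the `ε`-units of [B1] follow by the factor `ε^{−1}`,
resp. `ε^{−2}`); constants `d(D₁+D₂)/K₀`, `d(D₁+D₂)/K₀²` with r01's `D₁ = sup|h′|`, `D₂ = sup|h″|` and `d = P.d`; `K₀` (the print's `M`
in unit blocks) `≥ 8`.  Unit `lit-balaban-p35` gen 12 (literature-prover-lit-balaban-p35-g12-0).
-/

open scoped BigOperators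

noncomputable section

namespace Literature.MathematicalPhysics.QuantumFieldTheory.Balaban1983to89.B1TorusRegionHSizes

open Literature.MathematicalPhysics.QuantumFieldTheory.Balaban1983to89.HiggsLattice
open Literature.MathematicalPhysics.QuantumFieldTheory.Balaban1983to89.HiggsAveraging
open Literature.MathematicalPhysics.QuantumFieldTheory.Balaban1983to89.HiggsCovariancePos (shift_unshift unshift_shift)
open Literature.MathematicalPhysics.QuantumFieldTheory.Balaban1983to89.B2Ineq329ZeroAveraging (val_blockIter)
open Literature.MathematicalPhysics.QuantumFieldTheory.Balaban1983to89.B1TorusCubeCover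
open Literature.MathematicalPhysics.QuantumFieldTheory.Balaban1983to89.B1TorusCubeLocality26
open Literature.MathematicalPhysics.QuantumFieldTheory.Balaban1983to89.B1TorusCubeChart
open Literature.MathematicalPhysics.QuantumFieldTheory.Balaban1983to89.B1TorusCubeBoxOp (hTor_toT two_le_half blk_predL)
open Literature.MathematicalPhysics.QuantumFieldTheory.Balaban1983to89.B1TorusCubeDeriv (abs_hTor_shift_sub_le)
open Literature.MathematicalPhysics.QuantumFieldTheory.Balaban1983to89.B4Lower18Regular (e1)
open Literature.MathematicalPhysics.QuantumFieldTheory.Balaban1983to89.B4Reflection242 (boxDom mem_boxDom blk nbrs)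
open Literature.MathematicalPhysics.QuantumFieldTheory.Balaban1983to89.B4Lemma22ReduceZero (Box)
open Literature.MathematicalPhysics.QuantumFieldTheory.Balaban1983to89.B4PartitionUnity22 (hprof D1 D2 D1_nonneg D2_nonneg
  contDiff_hprof hasCompactSupport_hprof)
open Literature.MathematicalPhysics.QuantumFieldTheory.Balaban1983to89.B4Eq220PartitionSizes (hZ hBox hsize_hBox)
open Literature.MathematicalPhysics.QuantumFieldTheory.Balaban1983to89.B4Green242Bridge (boxNbrs boxBlk)
open Literature.MathematicalPhysics.QuantumFieldTheory.Balaban1983to89.B4Eq221HjRegion (hZ_add_e1_eq_of_dvd)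

variable {P : HiggsLattice.Params}

/-- `K₀ ≥ 8 ⇒ K₀ ≥ 1`. [folklore] -/
private theorem one_le_of_eight_le {K₀ : ℕ} (hK₀8 : 8 ≤ K₀) : 1 ≤ K₀ := le_trans (by norm_num) hK₀8

/-- `K₀ ≥ 8 ⇒ 3 ≤ (L−1+1)^K·K₀`. [folklore] -/
private theorem three_le_pow_mul {K K₀ : ℕ} (hK₀8 : 8 ≤ K₀) : 3 ≤ (P.L - 1 + 1) ^ K * K₀ :=
  le_trans (by norm_num) (Nat.mul_le_mul (Nat.one_le_pow _ _ (Nat.succ_pos _)) hK₀8)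

/-- `(L − 1 + 1)^K · K₀ = M` (the lineage's `n·K₀` is the half-side `half`). [cite: Balaban1983RegularityDecay, §2 p.575] -/
theorem predL_pow_mul (P : HiggsLattice.Params) (K K₀ : ℕ) : (P.L - 1 + 1) ^ K * K₀ = half P K K₀ := by
  rw [predL_succ]; rfl

/-! ## §1 Big-block regions of `T_ε` -/

section BigBlocks

variable (K K₀ : ℕ)

/-- **«thus Ω is a sum of the corresponding large blocks of the size M on η-lattice T_η»** — on the torus `T_ε`: membership in `Ω` depends
only on the big-block index `⌊x_μ/M⌋` of each
coordinate (`M = half = L^KK₀` fine sites; the big blocks are the cells of the cube lattice of gen 8).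
[cite: Balaban1983RegularityDecay, §2 p.575] [cite: Balaban1982Higgs1, Prop. 2.1 p.610] -/
def IsBigBlockUnion (Ω : Finset (HiggsLattice.Site P 0)) : Prop :=
  ∀ x x' : HiggsLattice.Site P 0, (∀ μ, (x μ).val / half P K K₀ = (x' μ).val / half P K K₀) → (x ∈ Ω ↔ x' ∈ Ω)

variable {K K₀}

/-- The whole torus is a big-block union (the case `Ω = T_ε` of gens 8–11). [cite: Balaban1982Higgs1, Prop. 2.1 p.610] -/
theorem isBigBlockUnion_univ : IsBigBlockUnion K K₀ (Finset.univ : Finset (HiggsLattice.Site P 0)) :=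
  fun _ _ _ => by simp

/-- The empty region is a big-block union. [cite: Balaban1983RegularityDecay, §2 p.575] -/
theorem isBigBlockUnion_empty : IsBigBlockUnion K K₀ (∅ : Finset (HiggsLattice.Site P 0)) :=
  fun _ _ _ => by simp

/-- **A BIG-BLOCK UNION IS A UNION OF `K`-BLOCKS** («Ω = B^k(Ω^{(k)})»): the shape hypothesis of r14's region coercivity (1.8)
(`B1Ineq18RegularRegion`) and of `B1TorusRegionCubes.piece_blockSat` (`K ≤ K_P`). [cite: Balaban1982Higgs1, Prop. 2.1 p.610] -/
theorem blockSat_of_isBigBlockUnion (hK : K ≤ P.K) {Ω : Finset (HiggsLattice.Site P 0)} (hΩ : IsBigBlockUnion K K₀ Ω) :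
    ∀ x x' : HiggsLattice.Site P 0, blockIter K x = blockIter K x' → (x ∈ Ω ↔ x' ∈ Ω) := by
  intro x x' h
  refine hΩ x x' fun μ => ?_
  have e := congrArg (fun y : HiggsLattice.Site P K => (y μ).val) h
  simp only [val_blockIter hK] at e
  unfold half
  rw [← Nat.div_div_eq_div_mul, ← Nat.div_div_eq_div_mul, e]

/-- **A BOUNDARY BOND CROSSES A FACE OF THE `M`-GRID**: if exactly one end of the bond `⟨x, x + εe_μ⟩` lies in the big-block union
`Ω`, then `M ∣ x_μ + 1` (the torus label `x_μ ∈ [0, |T_ε|_μ)`; `M ∣ |T_ε|_μ`). [cite: Balaban1983RegularityDecay, §2 p.575] -/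
theorem dvd_of_crossing (hK : K ≤ P.K) (hK₀ : K₀ ∣ P.M) {Ω : Finset (HiggsLattice.Site P 0)}
    (hΩ : IsBigBlockUnion K K₀ Ω) {x : HiggsLattice.Site P 0} {μ : Fin P.d} (hx : ¬ (x ∈ Ω ↔ x.shift μ ∈ Ω)) :
    half P K K₀ ∣ (x μ).val + 1 := by
  by_contra hnd
  apply hx
  refine hΩ x (x.shift μ) fun ν => ?_
  by_cases hν : ν = μ
  · subst hν
    have hS := nLab_mul_half hK hK₀ ν
    have hval : ((x.shift ν) ν).val = ((x ν).val + 1) % P.sitesPerDir 0 ν := by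
      show (Function.update x ν (x ν + 1) ν).val = _
      rw [Function.update_self, ZMod.val_add, ZMod.val_one_eq_one_mod, Nat.add_mod_mod]
    rw [hval]
    have hle : (x ν).val + 1 ≤ P.sitesPerDir 0 ν := ZMod.val_lt (x ν)
    have hlt : (x ν).val + 1 < P.sitesPerDir 0 ν := by
      rcases hle.lt_or_eq with h | h
      · exact h
      · exfalso
        apply hnd
        rw [h, ← hS]
        exact dvd_mul_left _ _
    rw [Nat.mod_eq_of_lt hlt, Nat.succ_div, if_neg hnd, add_zero]
  · have : (x.shift μ) ν = x ν := by
      show Function.update x μ (x μ + 1) ν = x ν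
      rw [Function.update_of_ne hν]
    rw [this]

end BigBlocks

/-! ## §2 The three sizes of `h_j` on the torus -/

section Sizes

variable {K K₀ : ℕ}

/-- Chart data at a core site: for `|x − Mj| ≤ rS` the chart point `z = fromT x` and its lattice neighbours `z ± e_i` lie in the box,
with `toT(z ± e_i) = x ± εe_{castD i}`. [cite: Balaban1983RegularityDecay, §2 p.575] -/
theorem chart_core (hK : K ≤ P.K) (hK₀ : K₀ ∣ P.M) (hK₀8 : 8 ≤ K₀) (hN3 : ∀ μ, 3 * half P K K₀ ≤ P.sitesPerDir 0 μ)
    (j : Lab P K K₀) {x : HiggsLattice.Site P 0} (hx : Near K K₀ (rS P K K₀) j x) (i : Fin (dd P + 1)) :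
    fromT K K₀ j x ∈ Box (dd P) (P.L - 1) K (M2 P K₀) ∧
      fromT K K₀ j x + e1 i ∈ Box (dd P) (P.L - 1) K (M2 P K₀) ∧
      fromT K K₀ j x - e1 i ∈ Box (dd P) (P.L - 1) K (M2 P K₀) ∧
      toT K K₀ j (fromT K K₀ j x + e1 i) = x.shift (castD P i) ∧
      toT K K₀ j (fromT K K₀ j x - e1 i) = x.unshift (castD P i) := by
  have hK₀' := one_le_of_eight_le hK₀8
  obtain ⟨hxc, hsc, huc⟩ := mem_cube_of_near hK₀8 hx (castD P i)
  have hz : fromT K K₀ j x ∈ Box (dd P) (P.L - 1) K (M2 P K₀) := (mem_cube_iff hK hK₀ hK₀' j x).1 hxc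
  have hxz : toT K K₀ j (fromT K K₀ j x) = x := toT_fromT j x
  have h2 : 2 ≤ half P K K₀ := two_le_half hK₀8
  refine ⟨hz, ?_, ?_, ?_, ?_⟩
  · exact (add_e1_mem_box_iff hK hK₀ hK₀' hN3 h2 j hz i).2 (by rw [hxz]; exact hsc)
  · exact (sub_e1_mem_box_iff hK hK₀ hK₀' hN3 h2 j hz i).2 (by rw [hxz]; exact huc)
  · rw [toT_add_e1, hxz]
  · rw [toT_sub_e1, hxz]

/-- `h_j` at a box point of the chart is the lineage's `hZ` at label `1`. [cite: Balaban1983RegularityDecay, §2 p.575] -/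
theorem hTor_toT_eq_hZ (hK : K ≤ P.K) (hK₀ : K₀ ∣ P.M) (hK₀' : 1 ≤ K₀) (j : Lab P K K₀) {y : Fin (dd P + 1) → ℤ}
    (hy : y ∈ Box (dd P) (P.L - 1) K (M2 P K₀)) :
    hTor K K₀ j (toT K K₀ j y) = hZ ((P.L - 1 + 1) ^ K) K₀ (fun _ : Fin (dd P + 1) => (1 : ℤ)) y :=
  hTor_toT hK hK₀ hK₀' j ⟨y, hy⟩

/-- Off the core all of `h_j(x)`, `h_j(x ± εe_μ)` vanish. [cite: Balaban1983RegularityDecay, (2.7) p.576] -/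
theorem hTor_triple_eq_zero (hK : K ≤ P.K) (hK₀ : K₀ ∣ P.M) (hK₀8 : 8 ≤ K₀) (j : Lab P K K₀) {x : HiggsLattice.Site P 0}
    (hx : ¬ Near K K₀ (rS P K K₀) j x) (μ : Fin P.d) :
    hTor K K₀ j x = 0 ∧ hTor K K₀ j (x.shift μ) = 0 ∧ hTor K K₀ j (x.unshift μ) = 0 := by
  refine ⟨?_, ?_, ?_⟩
  · by_contra h; exact hx (near_rS_of_hTor_ne_zero hK hK₀ hK₀8 h)
  · by_contra h; exact hx (near_rS_of_hTor_shift_ne_zero hK hK₀ hK₀8 h)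
  · by_contra h; exact hx (near_rS_of_hTor_unshift_ne_zero hK hK₀ hK₀8 h)

/-- **«|Δ^ηh_j| ≤ O(M⁻²)» ON THE TORUS** (lattice units): for every site `x` and label `j`,
`|Σ_μ ((h_j(x+εe_μ) − h_j(x)) + (h_j(x−εe_μ) − h_j(x)))| ≤ d(D₁+D₂)/(K₀²·L^{2K})` — on the core the bump is the lineage's `hBox`
around an interior box point (`hsize_hBox.lap_le`), off the core all values vanish.
[cite: Balaban1983RegularityDecay, §2 p.577 «|Δ^ηh_j| ≤ O(M⁻²)»] -/
theorem abs_lapH_hTor_le (hK : K ≤ P.K) (hK₀ : K₀ ∣ P.M) (hK₀8 : 8 ≤ K₀) (hN3 : ∀ μ, 3 * half P K K₀ ≤ P.sitesPerDir 0 μ)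
    (j : Lab P K K₀) (x : HiggsLattice.Site P 0) :
    |∑ μ : Fin P.d, ((hTor K K₀ j (x.shift μ) - hTor K K₀ j x) + (hTor K K₀ j (x.unshift μ) - hTor K K₀ j x))|
      ≤ ((dd P : ℝ) + 1) * (D1 hprof + D2 hprof) / (K₀ : ℝ) ^ 2 / ((((P.L - 1 + 1) ^ K : ℕ) : ℝ)) ^ 2 := by
  have hK₀' := one_le_of_eight_le hK₀8
  have hn : 1 ≤ (P.L - 1 + 1) ^ K := Nat.one_le_pow _ _ (Nat.succ_pos _)
  have hD1 := D1_nonneg contDiff_hprof hasCompactSupport_hprof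
  have hD2 := D2_nonneg contDiff_hprof hasCompactSupport_hprof
  by_cases hx : Near K K₀ (rS P K K₀) j x
  · have hKM : ∀ ν, K₀ ∣ M2 P K₀ ν := fun ν => ⟨2, by unfold M2; ring⟩
    have hz : fromT K K₀ j x ∈ Box (dd P) (P.L - 1) K (M2 P K₀) := (chart_core hK hK₀ hK₀8 hN3 j hx 0).1
    have hxz : toT K K₀ j (fromT K K₀ j x) = x := toT_fromT j x
    have hHS := hsize_hBox (d := dd P) hn hK₀' (three_le_pow_mul hK₀8) hKM (fun _ : Fin (dd P + 1) => (1 : ℤ))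
    have hlap := hHS.lap_le ⟨fromT K K₀ j x, hz⟩
    -- the box neighbour sum is the torus second-difference sum
    have hsum : ∑ y ∈ boxNbrs (fun i => (P.L - 1 + 1) ^ K * M2 P K₀ i) ⟨fromT K K₀ j x, hz⟩,
        (hBox ((P.L - 1 + 1) ^ K) K₀ (M2 P K₀) (fun _ => (1 : ℤ)) y
          - hBox ((P.L - 1 + 1) ^ K) K₀ (M2 P K₀) (fun _ => (1 : ℤ)) ⟨fromT K K₀ j x, hz⟩)
        = ∑ μ : Fin P.d, ((hTor K K₀ j (x.shift μ) - hTor K K₀ j x) + (hTor K K₀ j (x.unshift μ) - hTor K K₀ j x)) := by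
      have e1' : ∑ y ∈ boxNbrs (fun i => (P.L - 1 + 1) ^ K * M2 P K₀ i) ⟨fromT K K₀ j x, hz⟩,
          (hBox ((P.L - 1 + 1) ^ K) K₀ (M2 P K₀) (fun _ => (1 : ℤ)) y
            - hBox ((P.L - 1 + 1) ^ K) K₀ (M2 P K₀) (fun _ => (1 : ℤ)) ⟨fromT K K₀ j x, hz⟩)
          = ∑ y : ↥(boxDom fun i => (P.L - 1 + 1) ^ K * M2 P K₀ i),
              (if y.1 ∈ nbrs (fromT K K₀ j x) then
                (hZ ((P.L - 1 + 1) ^ K) K₀ (fun _ : Fin (dd P + 1) => (1 : ℤ)) y.1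
                  - hZ ((P.L - 1 + 1) ^ K) K₀ (fun _ : Fin (dd P + 1) => (1 : ℤ)) (fromT K K₀ j x)) else 0) := by
        unfold boxNbrs
        rw [Finset.sum_filter]
        rfl
      rw [e1', B1TorusCubeBoxOp.sum_nbrs_box (fromT K K₀ j x)
          (fun w => hZ ((P.L - 1 + 1) ^ K) K₀ (fun _ : Fin (dd P + 1) => (1 : ℤ)) w
            - hZ ((P.L - 1 + 1) ^ K) K₀ (fun _ : Fin (dd P + 1) => (1 : ℤ)) (fromT K K₀ j x)),
        ← (castD P).sum_comp]
      refine Finset.sum_congr rfl fun i _ => ?_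
      obtain ⟨-, hzp, hzm, etp, etm⟩ := chart_core hK hK₀ hK₀8 hN3 j hx i
      have hzp' : fromT K K₀ j x + e1 i ∈ boxDom fun i => (P.L - 1 + 1) ^ K * M2 P K₀ i := hzp
      have hzm' : fromT K K₀ j x - e1 i ∈ boxDom fun i => (P.L - 1 + 1) ^ K * M2 P K₀ i := hzm
      rw [if_pos hzp', if_pos hzm', ← hTor_toT_eq_hZ hK hK₀ hK₀' j hzp, ← hTor_toT_eq_hZ hK hK₀ hK₀' j hzm,
        ← hTor_toT_eq_hZ hK hK₀ hK₀' j hz, etp, etm, hxz]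
    rw [hsum, abs_mul, abs_of_pos (by positivity : (0 : ℝ) < ((((P.L - 1 + 1) ^ K : ℕ) : ℝ)) ^ 2)] at hlap
    rw [le_div_iff₀ (by positivity), mul_comm]
    exact hlap
  · have h0 : ∀ μ, hTor K K₀ j x = 0 ∧ hTor K K₀ j (x.shift μ) = 0 ∧ hTor K K₀ j (x.unshift μ) = 0 :=
      hTor_triple_eq_zero hK hK₀ hK₀8 j hx
    rw [Finset.sum_eq_zero fun μ _ => by rw [(h0 μ).1, (h0 μ).2.1, (h0 μ).2.2]; ring, abs_zero]
    positivity

/-- **THE BLOCK OSCILLATION OF `h_j`**: `|h_j(x) − h_j(x′)| ≤ d(D₁+D₂)/K₀` for `x, x′` in one `K`-block (the size `δ₃` of the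
`R_k(A, ∂^ηh)`-term (2.8): «|∂^ηh_j| ≤ O(M⁻¹)» summed along a block contour of length `≤ dL^K`; `hsize_hBox.osc_le` along the chart).
[cite: Balaban1983RegularityDecay, (2.8) p.576, p.577 «|∂^ηh_j| ≤ O(M⁻¹)»] -/
theorem abs_hTor_sub_le_of_blockIter_eq (hK : K ≤ P.K) (hK₀ : K₀ ∣ P.M) (hK₀8 : 8 ≤ K₀)
    (hN3 : ∀ μ, 3 * half P K K₀ ≤ P.sitesPerDir 0 μ) (j : Lab P K K₀) {x x' : HiggsLattice.Site P 0}
    (hb : blockIter K x = blockIter K x') :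
    |hTor K K₀ j x - hTor K K₀ j x'| ≤ ((dd P : ℝ) + 1) * (D1 hprof + D2 hprof) / K₀ := by
  have hK₀' := one_le_of_eight_le hK₀8
  have hn : 1 ≤ (P.L - 1 + 1) ^ K := Nat.one_le_pow _ _ (Nat.succ_pos _)
  have hD1 := D1_nonneg contDiff_hprof hasCompactSupport_hprof
  have hD2 := D2_nonneg contDiff_hprof hasCompactSupport_hprof
  by_cases hne : hTor K K₀ j x ≠ 0 ∨ hTor K K₀ j x' ≠ 0
  · -- both sites are within `rS` of `Mj`
    have hx : Near K K₀ (rS P K K₀) j x := by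
      rcases hne with h | h
      · exact near_rS_of_hTor_ne_zero hK hK₀ hK₀8 h
      · exact near_rS_of_block hK hK₀ hK₀8 h hb
    have hx' : Near K K₀ (rS P K K₀) j x' := by
      rcases hne with h | h
      · exact near_rS_of_block hK hK₀ hK₀8 h hb.symm
      · exact near_rS_of_hTor_ne_zero hK hK₀ hK₀8 h
    have hz : fromT K K₀ j x ∈ Box (dd P) (P.L - 1) K (M2 P K₀) := (chart_core hK hK₀ hK₀8 hN3 j hx 0).1
    have hz' : fromT K K₀ j x' ∈ Box (dd P) (P.L - 1) K (M2 P K₀) := (chart_core hK hK₀ hK₀8 hN3 j hx' 0).1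
    have hKM : ∀ ν, K₀ ∣ M2 P K₀ ν := fun ν => ⟨2, by unfold M2; ring⟩
    have hHS := hsize_hBox (d := dd P) hn hK₀' (three_le_pow_mul hK₀8) hKM (fun _ : Fin (dd P + 1) => (1 : ℤ))
    have hblk : blk ((P.L - 1 + 1) ^ K) (fromT K K₀ j x') = blk ((P.L - 1 + 1) ^ K) (fromT K K₀ j x) := by
      rw [blk_predL, blk_predL]
      exact (blockIter_toT_eq_iff hK hN3 j hz' hz).1 (by rw [toT_fromT, toT_fromT]; exact hb.symm)
    have hmem : (⟨fromT K K₀ j x', hz'⟩ : ↥(Box (dd P) (P.L - 1) K (M2 P K₀)))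
        ∈ boxBlk ((P.L - 1 + 1) ^ K) (fun i => (P.L - 1 + 1) ^ K * M2 P K₀ i) ⟨fromT K K₀ j x, hz⟩ := by
      unfold boxBlk
      rw [Finset.mem_filter]
      exact ⟨Finset.mem_univ _, hblk⟩
    have hosc := hHS.osc_le ⟨fromT K K₀ j x, hz⟩ ⟨fromT K K₀ j x', hz'⟩ hmem
    have e1' := hTor_toT_eq_hZ hK hK₀ hK₀' j hz
    have e2' := hTor_toT_eq_hZ hK hK₀ hK₀' j hz'
    rw [toT_fromT] at e1' e2'
    rw [e1', e2']
    exact hosc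
  · push Not at hne
    rw [hne.1, hne.2, sub_zero, abs_zero]
    positivity

end Sizes

/-! ## §3 The flat normal of `h_j` across the faces of the `M`-grid -/

section Flat

variable {K K₀ : ℕ}

/-- The box coordinate is congruent to the torus label minus the window corner: `M ∣ x_μ + 1 ⇒ M ∣ (fromT x)_i + 1` (`castD i = μ`;
the corner `Mj − M` and the period `|T_ε|_μ` are multiples of `M`). [cite: Balaban1983RegularityDecay, §2 p.575] -/
theorem dvd_fromT_succ_of_dvd (hK : K ≤ P.K) (hK₀ : K₀ ∣ P.M) (j : Lab P K K₀) {x : HiggsLattice.Site P 0} {μ : Fin P.d}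
    (hd : half P K K₀ ∣ (x μ).val + 1) :
    (half P K K₀ : ℤ) ∣ fromT K K₀ j x ((castD P).symm μ) + 1 := by
  have hμ : castD P ((castD P).symm μ) = μ := Equiv.apply_symm_apply _ _
  show (half P K K₀ : ℤ) ∣ boxCoord K K₀ j x (castD P ((castD P).symm μ)) + 1
  rw [hμ]
  -- `boxCoord + 1 ≡ x_μ + 1 − (Mj − M)  (mod |T_ε|_μ)`
  have hbc : ((boxCoord K K₀ j x μ + 1 : ℤ) : ZMod (P.sitesPerDir 0 μ))
      = ((((x μ).val : ℤ) + 1 - (ctr K K₀ j μ - half P K K₀) : ℤ) : ZMod (P.sitesPerDir 0 μ)) := by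
    have e1' : ((boxCoord K K₀ j x μ : ℤ) : ZMod (P.sitesPerDir 0 μ))
        = x μ - ((ctr K K₀ j μ - half P K K₀ : ℤ) : ZMod (P.sitesPerDir 0 μ)) := by
      show ((((x μ - ((ctr K K₀ j μ - half P K K₀ : ℤ) : ZMod (P.sitesPerDir 0 μ))).val : ℕ) : ℤ) :
          ZMod (P.sitesPerDir 0 μ)) = _
      rw [Int.cast_natCast, ZMod.natCast_zmod_val]
    rw [Int.cast_add (boxCoord K K₀ j x μ) 1, Int.cast_sub (((x μ).val : ℤ) + 1) (ctr K K₀ j μ - half P K K₀),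
      Int.cast_add (((x μ).val : ℤ)) 1, Int.cast_one, e1', Int.cast_natCast, ZMod.natCast_zmod_val]
    ring
  have hS : (half P K K₀ : ℤ) ∣ (P.sitesPerDir 0 μ : ℤ) := Int.natCast_dvd_natCast.2 (half_dvd hK hK₀ μ)
  have h1 : (half P K K₀ : ℤ) ∣ (((x μ).val : ℤ) + 1 - (ctr K K₀ j μ - half P K K₀)) - (boxCoord K K₀ j x μ + 1) :=
    hS.trans ((ZMod.intCast_eq_intCast_iff_dvd_sub _ _ _).1 hbc)
  have h2 : (half P K K₀ : ℤ) ∣ ((x μ).val : ℤ) + 1 := by exact_mod_cast hd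
  have hctr : (half P K K₀ : ℤ) ∣ ctr K K₀ j μ := by
    show (half P K K₀ : ℤ) ∣ (half P K K₀ : ℤ) * ((j μ : ℕ) : ℤ)
    exact dvd_mul_right _ _
  have h3 : (half P K K₀ : ℤ) ∣ ctr K K₀ j μ - half P K K₀ := hctr.sub (dvd_refl _)
  have e : boxCoord K K₀ j x μ + 1 = (((x μ).val : ℤ) + 1 - (ctr K K₀ j μ - half P K K₀))
      - ((((x μ).val : ℤ) + 1 - (ctr K K₀ j μ - half P K K₀)) - (boxCoord K K₀ j x μ + 1)) := by ring
  rw [e]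
  exact (h2.sub h3).sub h1

/-- **THE FLAT NORMAL**: if `M ∣ x_μ + 1` (the bond `⟨x, x + εe_μ⟩` crosses a face of the `M`-grid), then `h_j(x + εe_μ) = h_j(x)` for
every label `j` — the bump is locally constant across the faces through `Mj` (`h = 1` on the middle third) and vanishes across the
outer faces; the lineage's `hZ_add_e1_eq_of_dvd` along the chart (`K₀ ≥ 8`, `K ≤ K_P`, `K₀ ∣ M_P`, `3M ≤ |T_ε|_μ`).
[cite: Balaban1983RegularityDecay, (2.7) p.576 «the normal derivative of h_j to the boundary of □_j is equal to 0»] -/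
theorem hTor_shift_eq_of_dvd (hK : K ≤ P.K) (hK₀ : K₀ ∣ P.M) (hK₀8 : 8 ≤ K₀) (hN3 : ∀ μ, 3 * half P K K₀ ≤ P.sitesPerDir 0 μ)
    (j : Lab P K K₀) {x : HiggsLattice.Site P 0} {μ : Fin P.d} (hd : half P K K₀ ∣ (x μ).val + 1) :
    hTor K K₀ j (x.shift μ) = hTor K K₀ j x := by
  have hK₀' := one_le_of_eight_le hK₀8
  have hn : 1 ≤ (P.L - 1 + 1) ^ K := Nat.one_le_pow _ _ (Nat.succ_pos _)
  by_cases hne : hTor K K₀ j x ≠ 0 ∨ hTor K K₀ j (x.shift μ) ≠ 0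
  · have hx : Near K K₀ (rS P K K₀) j x :=
      hne.elim (near_rS_of_hTor_ne_zero hK hK₀ hK₀8) (near_rS_of_hTor_shift_ne_zero hK hK₀ hK₀8)
    have hμ : castD P ((castD P).symm μ) = μ := Equiv.apply_symm_apply _ _
    obtain ⟨hz, hzp, -, etp, -⟩ := chart_core hK hK₀ hK₀8 hN3 j hx ((castD P).symm μ)
    rw [hμ] at etp
    have hdz : (((P.L - 1 + 1) ^ K * K₀ : ℕ) : ℤ) ∣ fromT K K₀ j x ((castD P).symm μ) + 1 := by
      rw [predL_pow_mul]; exact dvd_fromT_succ_of_dvd hK hK₀ j hd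
    have hflat := hZ_add_e1_eq_of_dvd hn (three_le_pow_mul hK₀8) (fun _ : Fin (dd P + 1) => (1 : ℤ)) hdz
    have e0 := hTor_toT_eq_hZ hK hK₀ hK₀' j hz
    rw [toT_fromT] at e0
    rw [← etp, hTor_toT_eq_hZ hK hK₀ hK₀' j hzp, e0]
    exact hflat
  · push Not at hne
    rw [hne.1, hne.2]

/-- **ACROSS A BOUNDARY BOND OF A BIG-BLOCK UNION EVERY `h_j` IS FLAT**: if exactly one end of `⟨x, x + εe_μ⟩` lies in `Ω`, then
`h_j(x + εe_μ) = h_j(x)`. [cite: Balaban1983RegularityDecay, (2.7) p.576] -/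
theorem hTor_shift_eq_of_crossing (hK : K ≤ P.K) (hK₀ : K₀ ∣ P.M) (hK₀8 : 8 ≤ K₀) (hN3 : ∀ μ, 3 * half P K K₀ ≤ P.sitesPerDir 0 μ)
    {Ω : Finset (HiggsLattice.Site P 0)} (hΩ : IsBigBlockUnion K K₀ Ω) (j : Lab P K K₀) {x : HiggsLattice.Site P 0} {μ : Fin P.d}
    (hx : ¬ (x ∈ Ω ↔ x.shift μ ∈ Ω)) : hTor K K₀ j (x.shift μ) = hTor K K₀ j x :=
  hTor_shift_eq_of_dvd hK hK₀ hK₀8 hN3 j (dvd_of_crossing hK hK₀ hΩ hx)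

/-- **BONDS LEAVING THE WINDOW CARRY `h_j = 0` AT BOTH ENDS**: if `x + εe_μ ∉ □_j` then `h_j(x) = h_j(x + εe_μ) = 0` (`supp h_j` lies
within `rS` of `Mj`, whose lattice neighbourhood is inside `□_j`). [cite: Balaban1983RegularityDecay, (2.6) p.576] -/
theorem hTor_eq_zero_of_shift_not_mem_cube (hK : K ≤ P.K) (hK₀ : K₀ ∣ P.M) (hK₀8 : 8 ≤ K₀) (j : Lab P K K₀)
    {x : HiggsLattice.Site P 0} {μ : Fin P.d} (h : x.shift μ ∉ cube K K₀ j) :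
    hTor K K₀ j x = 0 ∧ hTor K K₀ j (x.shift μ) = 0 := by
  constructor
  · by_contra hne
    exact h (mem_cube_of_near hK₀8 (near_rS_of_hTor_ne_zero hK hK₀ hK₀8 hne) μ).2.1
  · by_contra hne
    exact h (mem_cube_of_near hK₀8 (near_rS_of_hTor_shift_ne_zero hK hK₀ hK₀8 hne) μ).2.1

/-- Symmetric form: if `x ∉ □_j` then `h_j(x) = h_j(x ± εe_μ) = 0`. [cite: Balaban1983RegularityDecay, (2.6) p.576] -/
theorem hTor_eq_zero_of_not_mem_cube (hK : K ≤ P.K) (hK₀ : K₀ ∣ P.M) (hK₀8 : 8 ≤ K₀) (j : Lab P K K₀)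
    {x : HiggsLattice.Site P 0} (h : x ∉ cube K K₀ j) (μ : Fin P.d) :
    hTor K K₀ j x = 0 ∧ hTor K K₀ j (x.shift μ) = 0 ∧ hTor K K₀ j (x.unshift μ) = 0 := by
  refine ⟨?_, ?_, ?_⟩
  · by_contra hne
    exact h (mem_cube_of_near hK₀8 (near_rS_of_hTor_ne_zero hK hK₀ hK₀8 hne) μ).1
  · by_contra hne
    exact h (mem_cube_of_near hK₀8 (near_rS_of_hTor_shift_ne_zero hK hK₀ hK₀8 hne) μ).1
  · by_contra hne
    exact h (mem_cube_of_near hK₀8 (near_rS_of_hTor_unshift_ne_zero hK hK₀ hK₀8 hne) μ).1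

end Flat

/-! ## §4 The Neumann Laplacian of `h_j` on a boundary piece is its full Laplacian -/

section Neumann

variable {K K₀ : ℕ}

/-- The NEUMANN Laplacian of a real lattice function on a piece `S ⊂ T_ε` at `x`, lattice units, bond set as in
`HiggsCovariance.covLaplacianN`: `Σ_μ (1[x, x+εe_μ ∈ S](h(x) − h(x+εe_μ)) + 1[x, x−εe_μ ∈ S](h(x) − h(x−εe_μ)))`.
[cite: Balaban1983RegularityDecay, (2.5) p.576 «(−Δ^{η,N}_Ω h)(x)»] -/
def nlapH (S : Finset (HiggsLattice.Site P 0)) (h : HiggsLattice.Site P 0 → ℝ) (x : HiggsLattice.Site P 0) : ℝ :=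
  ∑ μ : Fin P.d, ((if x ∈ S ∧ x.shift μ ∈ S then h x - h (x.shift μ) else 0)
    + (if x ∈ S ∧ x.unshift μ ∈ S then h x - h (x.unshift μ) else 0))

/-- The FULL lattice Laplacian `Σ_μ ((h(x) − h(x+εe_μ)) + (h(x) − h(x−εe_μ)))` (lattice units, sign of `−Δ`).
[cite: Balaban1983RegularityDecay, §2 p.577 «Δ^ηh_j»] -/
def flapH (h : HiggsLattice.Site P 0 → ℝ) (x : HiggsLattice.Site P 0) : ℝ :=
  ∑ μ : Fin P.d, ((h x - h (x.shift μ)) + (h x - h (x.unshift μ)))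

/-- **«THE NORMAL DERIVATIVE OF h_j TO THE BOUNDARY OF □_j IS EQUAL TO 0» ON THE TORUS**: for a big-block union `Ω` and the piece
`Π_j = Ω ∩ □_j`, at every `x ∈ Π_j` the Neumann Laplacian of `h_j` on `Π_j` equals its full Laplacian — every bond of `x` leaving `Π_j`
either crosses a face of `Ω` (flat normal) or leaves the window (both values vanish).
[cite: Balaban1983RegularityDecay, (2.7) p.576] -/
theorem nlapH_piece_eq_flapH (hK : K ≤ P.K) (hK₀ : K₀ ∣ P.M) (hK₀8 : 8 ≤ K₀) (hN3 : ∀ μ, 3 * half P K K₀ ≤ P.sitesPerDir 0 μ)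
    {Ω : Finset (HiggsLattice.Site P 0)} (hΩ : IsBigBlockUnion K K₀ Ω) (j : Lab P K K₀) {x : HiggsLattice.Site P 0}
    (hx : x ∈ Ω ∩ cube K K₀ j) :
    nlapH (Ω ∩ cube K K₀ j) (hTor K K₀ j) x = flapH (hTor K K₀ j) x := by
  have hxΩ : x ∈ Ω := (Finset.mem_inter.mp hx).1
  unfold nlapH flapH
  refine Finset.sum_congr rfl fun μ _ => ?_
  congr 1
  · -- forward bond
    by_cases hs : x.shift μ ∈ Ω ∩ cube K K₀ j
    · have hc : x ∈ Ω ∩ cube K K₀ j ∧ x.shift μ ∈ Ω ∩ cube K K₀ j := ⟨hx, hs⟩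
      rw [if_pos hc]
    · have hc : ¬ (x ∈ Ω ∩ cube K K₀ j ∧ x.shift μ ∈ Ω ∩ cube K K₀ j) := fun h => hs h.2
      rw [if_neg hc]
      by_cases hcube : x.shift μ ∈ cube K K₀ j
      · -- the bond crosses a face of `Ω`
        have hΩ' : x.shift μ ∉ Ω := fun h => hs (Finset.mem_inter.mpr ⟨h, hcube⟩)
        have hcross : ¬ (x ∈ Ω ↔ x.shift μ ∈ Ω) := fun h => hΩ' (h.mp hxΩ)
        rw [hTor_shift_eq_of_crossing hK hK₀ hK₀8 hN3 hΩ j hcross, sub_self]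
      · -- the bond leaves the window
        obtain ⟨h0, h1⟩ := hTor_eq_zero_of_shift_not_mem_cube hK hK₀ hK₀8 j hcube
        rw [h0, h1, sub_self]
  · -- backward bond
    by_cases hs : x.unshift μ ∈ Ω ∩ cube K K₀ j
    · have hc : x ∈ Ω ∩ cube K K₀ j ∧ x.unshift μ ∈ Ω ∩ cube K K₀ j := ⟨hx, hs⟩
      rw [if_pos hc]
    · have hc : ¬ (x ∈ Ω ∩ cube K K₀ j ∧ x.unshift μ ∈ Ω ∩ cube K K₀ j) := fun h => hs h.2
      rw [if_neg hc]
      by_cases hcube : x.unshift μ ∈ cube K K₀ j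
      · have hΩ' : x.unshift μ ∉ Ω := fun h => hs (Finset.mem_inter.mpr ⟨h, hcube⟩)
        have hcross : ¬ (x.unshift μ ∈ Ω ↔ (x.unshift μ).shift μ ∈ Ω) := by
          rw [shift_unshift]
          exact fun h => hΩ' (h.mpr hxΩ)
        have h := hTor_shift_eq_of_crossing hK hK₀ hK₀8 hN3 hΩ j hcross
        rw [shift_unshift] at h
        rw [h, sub_self]
      · obtain ⟨h0, h1, -⟩ := hTor_eq_zero_of_not_mem_cube hK hK₀ hK₀8 j hcube μ
        rw [shift_unshift] at h1
        rw [h0, h1, sub_self]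

/-- **«|Δ^ηh_j| ≤ O(M⁻²)»** for the full lattice Laplacian: `|(Δh_j)(x)| ≤ d(D₁+D₂)/(K₀²L^{2K})`.
[cite: Balaban1983RegularityDecay, §2 p.577] -/
theorem abs_flapH_hTor_le (hK : K ≤ P.K) (hK₀ : K₀ ∣ P.M) (hK₀8 : 8 ≤ K₀) (hN3 : ∀ μ, 3 * half P K K₀ ≤ P.sitesPerDir 0 μ)
    (j : Lab P K K₀) (x : HiggsLattice.Site P 0) :
    |flapH (hTor K K₀ j) x| ≤ ((dd P : ℝ) + 1) * (D1 hprof + D2 hprof) / (K₀ : ℝ) ^ 2 / ((((P.L - 1 + 1) ^ K : ℕ) : ℝ)) ^ 2 := by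
  have h := abs_lapH_hTor_le hK hK₀ hK₀8 hN3 j x
  have e : flapH (hTor K K₀ j) x
      = -∑ μ : Fin P.d, ((hTor K K₀ j (x.shift μ) - hTor K K₀ j x) + (hTor K K₀ j (x.unshift μ) - hTor K K₀ j x)) := by
    unfold flapH
    rw [← Finset.sum_neg_distrib]
    exact Finset.sum_congr rfl fun μ _ => by ring
  rw [e, abs_neg]
  exact h

/-- **THE NEUMANN LAPLACIAN OF `h_j` ON A BOUNDARY PIECE IS `O(M⁻²)`**: for a big-block union `Ω` and `x ∈ Ω ∩ □_j`,
`|(Δ^N_{Ω∩□_j}h_j)(x)| ≤ d(D₁+D₂)/(K₀²L^{2K})`. [cite: Balaban1983RegularityDecay, (2.7) p.576, p.577 «|Δ^ηh_j| ≤ O(M⁻²)»] -/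
theorem abs_nlapH_piece_le (hK : K ≤ P.K) (hK₀ : K₀ ∣ P.M) (hK₀8 : 8 ≤ K₀) (hN3 : ∀ μ, 3 * half P K K₀ ≤ P.sitesPerDir 0 μ)
    {Ω : Finset (HiggsLattice.Site P 0)} (hΩ : IsBigBlockUnion K K₀ Ω) (j : Lab P K K₀) {x : HiggsLattice.Site P 0}
    (hx : x ∈ Ω ∩ cube K K₀ j) :
    |nlapH (Ω ∩ cube K K₀ j) (hTor K K₀ j) x|
      ≤ ((dd P : ℝ) + 1) * (D1 hprof + D2 hprof) / (K₀ : ℝ) ^ 2 / ((((P.L - 1 + 1) ^ K : ℕ) : ℝ)) ^ 2 := by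
  rw [nlapH_piece_eq_flapH hK hK₀ hK₀8 hN3 hΩ j hx]
  exact abs_flapH_hTor_le hK hK₀ hK₀8 hN3 j x

/-- Off the piece the Neumann Laplacian of anything vanishes (no bond of `S` at `x ∉ S`). [cite: Balaban1983RegularityDecay, (2.5) p.576] -/
theorem nlapH_eq_zero_of_not_mem {S : Finset (HiggsLattice.Site P 0)} (h : HiggsLattice.Site P 0 → ℝ) {x : HiggsLattice.Site P 0}
    (hx : x ∉ S) : nlapH S h x = 0 := by
  unfold nlapH
  refine Finset.sum_eq_zero fun μ _ => ?_
  have h1 : ¬ (x ∈ S ∧ x.shift μ ∈ S) := fun h' => hx h'.1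
  have h2 : ¬ (x ∈ S ∧ x.unshift μ ∈ S) := fun h' => hx h'.1
  rw [if_neg h1, if_neg h2, add_zero]

end Neumann

end Literature.MathematicalPhysics.QuantumFieldTheory.Balaban1983to89.B1TorusRegionHSizes
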